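import Literature.AlgebraicGeometry.HodgeTheory.DivisorClassesFiniteEtaleBaseChange
import Literature.AlgebraicGeometry.FundamentalGroup.RiemannExistenceSmooth
import HarnessLib

/-!
# The finite étale cover of a smooth complex variety attached to a finite-index subgroup of `π₁` — hypothesis-free, every dimension

Family `hodge`, layer `Literature/AlgebraicGeometry/HodgeTheory` (lane `lit-hodgefound`, Layer B,
DAG-B nodes **B1-15** / **B3-15**: step 1 of the printed proofs of Deligne 1982 Thm. 2.15 and
André 1996 Cor. 5.1, «le sous-groupe d'indice fini définit un revêtement étale `S' → S`»).
PROOF FILE: theorems only — no definition, no named fact (D-0026; net debt 0).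

The tree's `exists_finiteEtale_of_finiteIndex_of_riemannExistence`
(`DivisorClassesFiniteEtaleBaseChange.lean`) produces, for a smooth irreducible quasi-projective
complex `S`, `s ∈ S(ℂ)` and a finite-index subgroup `H ≤ π₁(S(ℂ), s)`, a FINITE ÉTALE `g : S' ⟶ S`
with `S'(ℂ)` path connected, a point `s'` over `s`, and all loops at `s'` mapping into `H` —
GRANTED the named fact `FundamentalGroup.riemannExistence_finiteCovering` (SGA 1 XII Thm. 5.1 for
ALL quasi-projective `S`); `exists_finiteEtale_of_finiteIndex_smoothCurve`
(`FiniteEtaleCoverOfFiniteIndexSmoothCurve.lean`) is the unconditional version over smooth CURVES.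
Meanwhile Riemann's existence theorem has become a THEOREM of the tree for smooth irreducible
quasi-projective `S` of EVERY dimension — `FundamentalGroup.riemannExistence_smooth`
(`FundamentalGroup/RiemannExistenceSmooth.lean`: SGA 1 XII Thm. 5.1, essential surjectivity, proved
through Hörmander's `L²` estimates, Theorem B′ and the algebraisation Theorem A). This file records
the consequence:

* `exists_finiteEtale_of_finiteIndex_smooth` — for `S` quasi-projective, irreducible and smooth of
  relative dimension `d` over `ℂ`, `s ∈ S(ℂ)`, `H ≤ π₁(S(ℂ), s)` of finite index: a finite étale
  `g : S' ⟶ S`, `S'(ℂ)` path connected, `s'` over `s`, every loop at `s'` maps by `g(ℂ)` into `H`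
  — WITHOUT the named fact (same statement as `exists_finiteEtale_of_finiteIndex_of_riemannExistence`
  minus its hypothesis `hRE`; same proof, the fact replaced by the theorem);
* `exists_finiteEtale_of_finiteIndex_of_smooth` — the same with `Smooth S.hom` instead of a chosen
  relative dimension (a smooth `S ⟶ Spec ℂ` is smooth of some relative dimension,
  `Motives.exists_smoothOfRelativeDimension_of_smooth`).

Consumers (sibling files of this proposal series): the hypothesis
`hRE : FundamentalGroup.riemannExistence_finiteCovering` of the tree's Deligne-1982 Thm. 2.15 files
(`Deligne1982/PrincipleBFiniteMonodromy.lean`, `Deligne1982/PrincipleBLocalSubsystemProjective.lean`)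
and André-1996 Cor. 5.1 file (`Andre1996/MonodromyInvariantMotivatedClasses.lean`) is discharged
over their (smooth, quasi-projective) bases.

## References

* [SGA1] A. Grothendieck, M. Raynaud, *Revêtements étales et groupe fondamental (SGA 1)*, LNM 224
  / arXiv:math/0206203, Exp. XII Thm. 5.1 (p. 333) and Prop. 2.4.
* [HatcherAT2002] A. Hatcher, *Algebraic Topology*, CUP 2002, §1.3 Prop. 1.32, Prop. 1.36.
* [Deligne1982HodgeCycles] P. Deligne, Hodge cycles on abelian varieties, LNM 900 (1982), proof of
  Thm. 2.15 («after passing to a finite covering of `S`»).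
* [Andre1996Motifs] Y. André, Pour une théorie inconditionnelle des motifs, Publ. Math. IHÉS 83
  (1996), proof of Cor. 5.1 (p. 26).
* [Voisin2007HodgeLoci] C. Voisin, Hodge loci and absolute Hodge classes, Compositio Math. 143
  (2007), §3, proof of Prop. 0.7.

#harness_tags algebraic_geometry.sga1, complex_geometry.riemann_existence, algebraic_geometry.hodge_conjecture
-/

noncomputable section

open CategoryTheory AlgebraicGeometry
open _root_.Topology
open Literature.AlgebraicTopology.SingularHomology
open Literature.Topology.CoveringSpaces

namespace Literature.AlgebraicGeometry.HodgeTheory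

open Literature.AlgebraicGeometry.Motives

/-- **Riemann existence, finite-index form over a smooth complex variety of any dimension —
unconditionally.** For a quasi-projective, irreducible `ℂ`-scheme `S` smooth of relative dimension
`d`, `s ∈ S(ℂ)` and a finite-index subgroup `H ≤ π₁(S(ℂ), s)` (on the subspace `univ ⊆ S(ℂ)`, as the
tree's transport), there are a FINITE ÉTALE `g : S' ⟶ S` with `S'(ℂ)` path connected, a point `s'`
over `s`, and every loop at `s'` maps by `g(ℂ)` into `H`: the covering of the connected manifold
`S(ℂ)` attached to the normal core of `H` (Hatcher Prop. 1.36 / 1.32, the tree's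
`UniversalCover.exists_covering_of_normal`) is `S'(ℂ)` over `S(ℂ)` by the tree's THEOREM
`FundamentalGroup.riemannExistence_smooth` (SGA 1 XII Thm. 5.1 for smooth irreducible
quasi-projective complex varieties). Same statement as
`exists_finiteEtale_of_finiteIndex_of_riemannExistence` without its hypothesis `hRE`, same proof with
the named fact replaced by that theorem. [cite: SGA1, Exp. XII Thm. 5.1 (p. 333)]
[cite: HatcherAT2002, §1.3 Prop. 1.36 and Prop. 1.32] -/
theorem exists_finiteEtale_of_finiteIndex_smooth (S : SchemeOver ℂ) (hS : IsQuasiProjectiveOver S)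
    [IrreducibleSpace S.left] (d : ℕ) [SmoothOfRelativeDimension d S.hom] (s : ComplexPoints S)
    (H : Subgroup (FundamentalGroup (Set.univ : Set (ComplexPoints S)) ⟨s, Set.mem_univ s⟩))
    [H.FiniteIndex] :
    ∃ (S' : SchemeOver ℂ) (g : S' ⟶ S) (s' : ComplexPoints S') (hs : AlgPoints.map g s' = s),
      IsFinite g.left ∧ Etale g.left ∧ PathConnectedSpace (ComplexPoints S') ∧
      ∀ γ' : Path (⟨s', Set.mem_univ s'⟩ : (Set.univ : Set (ComplexPoints S'))) ⟨s', Set.mem_univ s'⟩,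
        FundamentalGroup.fromPath
          (⟦(γ'.map ((((AlgPoints.continuous_map g).comp continuous_subtype_val)).subtype_mk
              fun _ ↦ Set.mem_univ _)).cast (Subtype.ext hs.symm) (Subtype.ext hs.symm)⟧) ∈ H := by
  -- adapted from `exists_finiteEtale_of_finiteIndex_of_riemannExistence`: the named fact `hRE` is
  -- replaced by the tree's theorem `FundamentalGroup.riemannExistence_smooth`
  -- (i) `S(ℂ)` is a connected topological manifold: path connected, strongly locally contractible
  haveI : Smooth S.hom := SmoothOfRelativeDimension.smooth d S.hom
  haveI : LocallyOfFiniteType S.hom := hS.locallyOfFiniteType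
  letI := Motives.ComplexPoints.chartedSpace S d
  haveI : StronglyLocallyContractibleSpace (ComplexPoints S) :=
    Literature.AlgebraicTopology.Homotopy.stronglyLocallyContractibleSpace_of_chartedSpace_normedSpace
      (EuclideanSpace ℝ (Fin (2 * d))) _
  haveI : ConnectedSpace (ComplexPoints S) := connectedSpace_complexPoints_of_irreducibleSpace S
  haveI : PathConnectedSpace (ComplexPoints S) :=
    pathConnectedSpace_complexPoints_of_smoothOfRelativeDimension S d
  haveI : StronglyLocallyContractibleSpace (Set.univ : Set (ComplexPoints S)) :=
    isOpen_univ.stronglyLocallyContractibleSpace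
  haveI : PathConnectedSpace (Set.univ : Set (ComplexPoints S)) :=
    isPathConnected_iff_pathConnectedSpace.mp isPathConnected_univ
  -- (ii) the covering attached to the normal core `N ⊴ π₁(S(ℂ), s)` of `H` (Hatcher 1.36, 1.32)
  obtain ⟨T, _, q, hqc, t, ht, hcov, hTpc, hfin, hloop⟩ :=
    UniversalCover.exists_covering_of_normal (X := (Set.univ : Set (ComplexPoints S)))
      (x₀ := ⟨s, Set.mem_univ s⟩) H.normalCore
  haveI := hTpc
  let φ := Homeomorph.Set.univ (ComplexPoints S)
  have hcov' : IsCoveringMap (φ ∘ q) := hcov.homeomorph_comp φ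
  have hfin' : ∀ x, ((φ ∘ q) ⁻¹' {x}).Finite := fun x ↦ by
    refine (hfin (φ.symm x)).subset fun y hy ↦ ?_
    simp only [Set.mem_preimage, Set.mem_singleton_iff, Function.comp_apply] at hy ⊢
    rw [← hy, Homeomorph.symm_apply_apply]
  -- (iii) Riemann existence for the smooth irreducible quasi-projective `S` (a THEOREM of the
  -- tree): `T = S'(ℂ)` over `S(ℂ)` for a finite étale `g : S' ⟶ S`
  obtain ⟨S', g, Φ, hgfin, hget, hΦ⟩ :=
    FundamentalGroup.riemannExistence_smooth S hS T (φ ∘ q) hcov' hfin'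
  -- the base point `s'` matching `t`
  have hs : AlgPoints.map g (Φ.symm t) = s := by
    rw [← hΦ (Φ.symm t), Φ.apply_symm_apply, Function.comp_apply, ht]
    rfl
  haveI : PathConnectedSpace (ComplexPoints S') :=
    Φ.symm.surjective.pathConnectedSpace Φ.symm.continuous
  refine ⟨S', g, Φ.symm t, hs, hgfin, hget, inferInstance, fun γ' ↦ ?_⟩
  -- the loop clause: `g(ℂ) ∘ γ'` is `q ∘ δ` for the loop `δ = Φ ∘ γ'` at `t`
  let δ : Path t t :=
    (γ'.map (Φ.continuous.comp continuous_subtype_val)).cast (Φ.apply_symm_apply t).symm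
      (Φ.apply_symm_apply t).symm
  have hpath :
      ((γ'.map ((((AlgPoints.continuous_map g).comp continuous_subtype_val)).subtype_mk
          fun _ ↦ Set.mem_univ _)).cast (Subtype.ext hs.symm) (Subtype.ext hs.symm) :
        Path (⟨s, Set.mem_univ s⟩ : (Set.univ : Set (ComplexPoints S))) ⟨s, Set.mem_univ s⟩) =
      (δ.map hqc).cast ht.symm ht.symm := by
    apply Path.ext
    funext u
    apply Subtype.ext
    change AlgPoints.map g (γ' u).1 = (φ ∘ q) (Φ (γ' u).1)
    exact (hΦ _).symm
  rw [hpath]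
  exact H.normalCore_le (hloop δ)

/-- **Riemann existence, finite-index form over a smooth irreducible quasi-projective complex
variety (`Smooth S.hom`, no chosen relative dimension) — unconditionally.** A smooth `S ⟶ Spec ℂ`
is smooth of some relative dimension `d` (`Motives.exists_smoothOfRelativeDimension_of_smooth`), and
`exists_finiteEtale_of_finiteIndex_smooth` applies: for `s ∈ S(ℂ)` and a finite-index subgroup
`H ≤ π₁(S(ℂ), s)` there are a finite étale `g : S' ⟶ S` with `S'(ℂ)` path connected, `s'` over `s`,
and every loop at `s'` mapping by `g(ℂ)` into `H`. This is exactly the shape in which the tree's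
Deligne-1982 Thm. 2.15 / André-1996 Cor. 5.1 files consume Riemann existence over the base of a good
family. [cite: SGA1, Exp. XII Thm. 5.1 (p. 333)] [cite: HatcherAT2002, §1.3 Prop. 1.36 and Prop. 1.32] -/
theorem exists_finiteEtale_of_finiteIndex_of_smooth (S : SchemeOver ℂ) (hS : IsQuasiProjectiveOver S)
    [Smooth S.hom] [IrreducibleSpace S.left] (s : ComplexPoints S)
    (H : Subgroup (FundamentalGroup (Set.univ : Set (ComplexPoints S)) ⟨s, Set.mem_univ s⟩))
    [H.FiniteIndex] :
    ∃ (S' : SchemeOver ℂ) (g : S' ⟶ S) (s' : ComplexPoints S') (hs : AlgPoints.map g s' = s),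
      IsFinite g.left ∧ Etale g.left ∧ PathConnectedSpace (ComplexPoints S') ∧
      ∀ γ' : Path (⟨s', Set.mem_univ s'⟩ : (Set.univ : Set (ComplexPoints S'))) ⟨s', Set.mem_univ s'⟩,
        FundamentalGroup.fromPath
          (⟦(γ'.map ((((AlgPoints.continuous_map g).comp continuous_subtype_val)).subtype_mk
              fun _ ↦ Set.mem_univ _)).cast (Subtype.ext hs.symm) (Subtype.ext hs.symm)⟧) ∈ H := by
  obtain ⟨d, hd⟩ := Motives.exists_smoothOfRelativeDimension_of_smooth S.hom
  haveI := hd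
  exact exists_finiteEtale_of_finiteIndex_smooth S hS d s H

end Literature.AlgebraicGeometry.HodgeTheory

end
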